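import Literature.Probability.RandomPlanarGeometry.ConformalRestrictionThreeLeaves
import Literature.Probability.RandomPlanarGeometry.SLERestrictionMartingaleHolds
import Literature.Probability.RandomPlanarGeometry.RestrictionHullsHolds
import Literature.Probability.RandomPlanarGeometry.RestrictionMeasuresFiveEighthsProofs
import Literature.Probability.RandomPlanarGeometry.SLEBubblesVersionHolds
import HarnessLib

/-!
# [LSW] p. 5 result 2 (`LawlerSchrammWerner2003`) from the single remaining fact `eq_five_eighths_of_outer_simple`, i.e. from its five open leaves

G. F. Lawler, O. Schramm, W. Werner, *Conformal restriction: the chordal case*, J. Amer. Math.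
Soc. **16** (2003) 917–955, arXiv:math/0209343 (**[LSW]**), p. 5 result 2 ("The only measure
`P_α` that is supported on simple curves is `P_{5/8}`. It is the law of chordal SLE_{8/3}"),
assembled in the paper from Prop. 3.3, Thm. 6.1, Thm. 7.3 and Cor. 8.6.

Book-keeping file (no new definition, no new named fact, everything PROVED). Of the three leaves
of `LawlerSchrammWerner2003_of_local_leaf_facts''` (`ConformalRestrictionThreeLeaves`) two are now
theorems of the tree:

* trace existence for SLE_{8/3} — Rohde–Schramm 2005 Thm. 5.1, `hasSLETrace_eightThirds`
  (`RestrictionHullsHolds`, i.e. `hasSLETrace_of_ne_eight_holds` of `RohdeSchrammCor35Proofs`, from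
  the discharged derivative estimate `RohdeSchramm2005_cor35_holds`);
* the restriction martingale of [LSW] Prop. 5.2/5.3 — `sle_exists_isRestrictionMartingale_holds`
  (`SLERestrictionMartingaleHolds`).

Hence:

* `Literature.Probability.RandomPlanarGeometry.LawlerSchrammWerner2003_of_five_eighths` —
  **`LawlerSchrammWerner2003` follows from the single named fact
  `IsRestrictionMeasure.eq_five_eighths_of_outer_simple`** ([LSW] p. 5 result 2, first sentence:
  a two-sided restriction measure carried by simple curves has exponent `5/8`);
* `Literature.Probability.RandomPlanarGeometry.IsRestrictionMeasure.eq_five_eighths_of_outer_simple_of_five_leaves` —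
  that fact from the FIVE leaves that remain open after `RestrictionMeasuresFiveEighthsProofs`
  (Cor. 8.6 from two leaves) and `SLEBubblesVersionHolds` (the `α > 5/8` leaf from three
  leaves): on the §8 side the martingale of Lemmas 8.9–8.10 (`SLEKappaRho.exists_isOneSidedMartingale`)
  and the comparison sentence of p. 38 (`SLEKappaRho.measure_I_notMem_fill_lt_of_neg`); on the
  §7 side a Brownian bubble measure with interior points
  (`exists_isBrownianBubbleMeasure_ae_interior_nonempty`, §7.1), `Ξ(κ) ∈ Ω` almost surely
  (`SLEBubbles.ae_mem_restrictionConfigs`, end of the proof of Thm. 7.3) and Theorem 6.5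
  (`SLEBubbles.lintegral_poissonAvoidance_eq_rpow`);
* `Literature.Probability.RandomPlanarGeometry.LawlerSchrammWerner2003_of_five_leaves` — hence
  **`LawlerSchrammWerner2003` from those five leaves**.

So `LawlerSchrammWerner2003_holds` is `LawlerSchrammWerner2003_of_five_eighths
IsRestrictionMeasure.eq_five_eighths_of_outer_simple_holds`, equivalently
`LawlerSchrammWerner2003_of_five_leaves` applied to the five `_holds` theorems, once they exist.

## References

* [LSW] p. 5 result 2; Prop. 3.3 (p. 11), Prop. 5.2/5.3 and Thm. 6.1 (§5–6), Thm. 6.5,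
  Thm. 7.3 (p. 29), Thm. 8.4 and Cor. 8.6 (pp. 37–38). [LawlerSchrammWerner2003Restriction]
* S. Rohde, O. Schramm, *Basic properties of SLE*, Ann. of Math. **161** (2005), Cor. 3.5,
  Thm. 5.1, Thm. 6.1. [RohdeSchramm2005]
-/

noncomputable section

open MeasureTheory
open scoped NNReal

namespace Literature.Probability.RandomPlanarGeometry

/-- **[LSW] p. 5 result 2 ⇐ its first sentence.** `LawlerSchrammWerner2003` (a conformally
covariant chordal family with two-sided restriction carried by simple curves is chordal SLE_{8/3})
follows from the single named fact `IsRestrictionMeasure.eq_five_eighths_of_outer_simple` (a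
two-sided restriction measure carried by simple curves has exponent `5/8`): the three-leaf
assembly `LawlerSchrammWerner2003_of_local_leaf_facts''` with trace existence
(`hasSLETrace_eightThirds`, RS05 Thm. 5.1) and the restriction martingale of Prop. 5.2/5.3
(`sle_exists_isRestrictionMartingale_holds`) supplied by their discharges.
[cite: LawlerSchrammWerner2003Restriction, p. 5 result 2; Prop. 3.3, Thm. 6.1, Cor. 8.6] -/
theorem LawlerSchrammWerner2003_of_five_eighths
    (h58 : IsRestrictionMeasure.eq_five_eighths_of_outer_simple) : LawlerSchrammWerner2003 :=
  LawlerSchrammWerner2003_of_local_leaf_facts'' hasSLETrace_eightThirds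
    sle_exists_isRestrictionMartingale_holds h58

/-- **[LSW] p. 5 result 2, first sentence (outer reading), from the five open leaves**: Cor. 8.6
from the one-sided martingale of Lemmas 8.9–8.10 (`hM`) and the comparison sentence of p. 38
(`hlt`) (`not_exists_isRestrictionMeasure_of_lt_five_eighths_of_two_leaves`), and the `α > 5/8`
half from the bubble measure with interior points (`hμex`), `Ξ(κ) ∈ Ω` a.s. (`hcfg`) and
Theorem 6.5 (`h65`) (`IsRestrictionMeasure.ae_interior_nonempty_of_gt_five_eighths_of_three_leaves`),
glued by `IsRestrictionMeasure.eq_five_eighths_of_outer_simple_of_facts`.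
[cite: LawlerSchrammWerner2003Restriction, p. 5 result 2; Thm. 7.3 (p. 29), Thm. 8.4 (p. 37), Cor. 8.6 (pp. 37–38)] -/
theorem IsRestrictionMeasure.eq_five_eighths_of_outer_simple_of_five_leaves
    (hM : SLEKappaRho.exists_isOneSidedMartingale)
    (hlt : SLEKappaRho.measure_I_notMem_fill_lt_of_neg)
    (hμex : exists_isBrownianBubbleMeasure_ae_interior_nonempty)
    (hcfg : SLEBubbles.ae_mem_restrictionConfigs)
    (h65 : SLEBubbles.lintegral_poissonAvoidance_eq_rpow) :
    IsRestrictionMeasure.eq_five_eighths_of_outer_simple :=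
  IsRestrictionMeasure.eq_five_eighths_of_outer_simple_of_facts
    (not_exists_isRestrictionMeasure_of_lt_five_eighths_of_two_leaves hM hlt)
    (IsRestrictionMeasure.ae_interior_nonempty_of_gt_five_eighths_of_three_leaves hμex hcfg h65)

/-- The almost-everywhere reading (`IsRestrictionMeasure.eq_five_eighths_of_simple`) from the same
five leaves. [cite: LawlerSchrammWerner2003Restriction, p. 5 result 2] -/
theorem IsRestrictionMeasure.eq_five_eighths_of_simple_of_five_leaves
    (hM : SLEKappaRho.exists_isOneSidedMartingale)
    (hlt : SLEKappaRho.measure_I_notMem_fill_lt_of_neg)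
    (hμex : exists_isBrownianBubbleMeasure_ae_interior_nonempty)
    (hcfg : SLEBubbles.ae_mem_restrictionConfigs)
    (h65 : SLEBubbles.lintegral_poissonAvoidance_eq_rpow) :
    IsRestrictionMeasure.eq_five_eighths_of_simple :=
  IsRestrictionMeasure.eq_five_eighths_of_simple_of_outer
    (IsRestrictionMeasure.eq_five_eighths_of_outer_simple_of_five_leaves hM hlt hμex hcfg h65)

/-- **`LawlerSchrammWerner2003` from the five open leaves** (the martingale of [LSW]
Lemmas 8.9–8.10, the comparison sentence of p. 38, the Brownian bubble measure of §7.1,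
`Ξ(κ) ∈ Ω` a.s., Theorem 6.5); Prop. 3.3, Thm. 6.1 (with RS05 Thm. 5.1 and Prop. 5.2/5.3),
Kingman's theorem, Lemmas 6.2, 6.3, 8.3 and the rest of §7–8 being theorems of the tree.
[cite: LawlerSchrammWerner2003Restriction, p. 5 result 2; Prop. 3.3, Thm. 6.1, Thm. 7.3, Thm. 8.4, Cor. 8.6] -/
theorem LawlerSchrammWerner2003_of_five_leaves
    (hM : SLEKappaRho.exists_isOneSidedMartingale)
    (hlt : SLEKappaRho.measure_I_notMem_fill_lt_of_neg)
    (hμex : exists_isBrownianBubbleMeasure_ae_interior_nonempty)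
    (hcfg : SLEBubbles.ae_mem_restrictionConfigs)
    (h65 : SLEBubbles.lintegral_poissonAvoidance_eq_rpow) : LawlerSchrammWerner2003 :=
  LawlerSchrammWerner2003_of_five_eighths
    (IsRestrictionMeasure.eq_five_eighths_of_outer_simple_of_five_leaves hM hlt hμex hcfg h65)

end Literature.Probability.RandomPlanarGeometry

end
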